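import Summits.QuantumFields.GaugeBoot.BootstrapCertificateTransport
import HarnessLib

/-!
# Inner semicontinuity of the feasible sets of a parametric conic program under a comparable Slater family and a finite-rank regulariser (gauge-boot, L1/L4 supplement)

HONEST FRAMING (cell `pub-gaugeboot`, page 1 of every file): the venture produces certified bounds
on lattice expectations at stated coupling, gauge group, dimension and torus size; NOT a mass gap,
NOT a continuum limit, NOT a string tension; NOT Yang–Mills-summit-bearing (barriers
`FixedCouplingUltralocality`, `PerturbativeInvisibility`). Pure (linear-algebraic) convex
analysis; it certifies no number.

## Content (the abstract half of "the level-`n` SDP value is continuous in `β` off a finite set")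

A parametric family of conic feasibility problems on a real vector space `E` (no topology on `E`):
`Feasible K u R = {φ : E →ₗ ℝ | φ u = 1, φ ≥ 0 on K, φ = 0 on R}` — for the lattice bootstrap
`K` = the SOS cone of the level-`n` test functions, `u = 1`, `R = R(β)` the span of the level-`n`
loop-equation rows at coupling `β`. The feasible-set map `β ↦ Feasible K u (R β)` is INNER
SEMICONTINUOUS at `β₀` (every feasible `φ₀` at `β₀` is approximated, in the value of any fixed
objective `P`, by feasible functionals at all nearby `β`) provided:

* (Slater family) feasible `ψ_β` exist near `β₀`, COMPARABLE on the cone — `m ψ_{β₀} ≤ ψ_β` on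
  `K` for a fixed `m > 0` (for Gibbs states: the densities `e^{-βS}` at nearby couplings are
  comparable) — with `ψ_β P` bounded;
* (regular rows) a finite-rank regulariser `Q_β x = Σ_i π_i(x) g_i(β)` restricting to the identity
  on `R(β)` near `β₀`, with `g_i(β₀) ∈ R(β₀)`, each `β ↦ φ(g_i β)` continuous at `β₀`, and the
  functionals `π_i` dominated on `K` by `ψ_{β₀}` (`|π_i x| ≤ D ψ_{β₀} x`) — supplied, where the
  row space has locally constant dimension, by `RowPencil.lean`.

★★ `ConicStability.inner_semicontinuous` — under these hypotheses, for every
`φ₀ ∈ Feasible K u (R β₀)` and `ε > 0`: for all `β` near `β₀` some `φ ∈ Feasible K u (R β)` has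
`|φ P - φ₀ P| < ε`. Mechanism: `φ₀ ∘ (1 - Q_β)` kills `R(β)`, is `≥ -e(β) ψ_{β₀}` on `K` with
`e(β) → 0`, and is repaired by adding `(e(β)/m) ψ_β` and renormalising. Corollaries
`lowerSemicontinuousAt_sSup`, `upperSemicontinuousAt_sInf`: the optimal values `β ↦ sup φ P`,
`β ↦ inf φ P` are lower, resp. upper, semicontinuous at `β₀` (attained at `β₀`, bounded nearby).

References: J. F. Bonnans, A. Shapiro, Perturbation Analysis of Optimization Problems (Springer
2000), Ch. 4 (stability under Robinson's constraint qualification); S. M. Robinson, Math. Oper.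
Res. 1 (1976) 130. Folklore.
-/

noncomputable section

open Filter Topology

namespace Summit.QuantumFields.GaugeBoot.ConicStability

variable {E : Type*} [AddCommGroup E] [Module ℝ E]

/-- **The feasible set of the conic program** with cone `K`, normalisation `φ u = 1` and equality
constraints `φ = 0` on the subspace `R`. [folklore] -/
def Feasible (K : Set E) (u : E) (R : Submodule ℝ E) : Set (E →ₗ[ℝ] ℝ) :=
  {φ | φ u = 1 ∧ (∀ x ∈ K, 0 ≤ φ x) ∧ ∀ x ∈ R, φ x = 0}

/-- Membership in `Feasible`, unfolded. -/
theorem mem_feasible_iff {K : Set E} {u : E} {R : Submodule ℝ E} {φ : E →ₗ[ℝ] ℝ} :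
    φ ∈ Feasible K u R ↔ φ u = 1 ∧ (∀ x ∈ K, 0 ≤ φ x) ∧ ∀ x ∈ R, φ x = 0 := Iff.rfl

/-- **Renormalising a functional which is positive on `u`, non-negative on `K` and zero on `R` gives
a feasible functional.** -/
theorem smul_mem_feasible {K : Set E} {u : E} {R : Submodule ℝ E} {χ : E →ₗ[ℝ] ℝ} (hu : 0 < χ u)
    (hK : ∀ x ∈ K, 0 ≤ χ x) (hR : ∀ x ∈ R, χ x = 0) : (χ u)⁻¹ • χ ∈ Feasible K u R := by
  refine ⟨?_, fun x hx => ?_, fun x hx => ?_⟩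
  · rw [LinearMap.smul_apply, smul_eq_mul, inv_mul_cancel₀ hu.ne']
  · rw [LinearMap.smul_apply, smul_eq_mul]
    exact mul_nonneg (inv_nonneg.2 hu.le) (hK x hx)
  · rw [LinearMap.smul_apply, smul_eq_mul, hR x hx, mul_zero]

/-- ★★ **Inner semicontinuity of the feasible sets** under a comparable Slater family and a
finite-rank regulariser of the equality constraints (see the module docstring). For every feasible
`φ₀` at `β₀` and `ε > 0`, at all `β` near `β₀` some feasible `φ` has `|φ P - φ₀ P| < ε`.
[folklore] -/
theorem inner_semicontinuous {K : Set E} {u P : E} {R : ℝ → Submodule ℝ E} {β₀ : ℝ}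
    {ψ : ℝ → (E →ₗ[ℝ] ℝ)} (hψF : ∀ᶠ β in 𝓝 β₀, ψ β ∈ Feasible K u (R β))
    {m : ℝ} (hm : 0 < m) (hψK : ∀ᶠ β in 𝓝 β₀, ∀ x ∈ K, m * ψ β₀ x ≤ ψ β x)
    {B : ℝ} (hψP : ∀ᶠ β in 𝓝 β₀, |ψ β P| ≤ B)
    {s : ℕ} (π : Fin s → (E →ₗ[ℝ] ℝ)) (g : Fin s → ℝ → E)
    (hQ : ∀ᶠ β in 𝓝 β₀, ∀ x ∈ R β, ∑ i, π i x • g i β = x)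
    (hg₀ : ∀ i, g i β₀ ∈ R β₀)
    (hgc : ∀ (φ : E →ₗ[ℝ] ℝ) (i : Fin s), ContinuousAt (fun β => φ (g i β)) β₀)
    {D : ℝ} (hD0 : 0 ≤ D) (hD : ∀ i, ∀ x ∈ K, |π i x| ≤ D * ψ β₀ x)
    {φ₀ : E →ₗ[ℝ] ℝ} (hφ₀ : φ₀ ∈ Feasible K u (R β₀)) {ε : ℝ} (hε : 0 < ε) :
    ∀ᶠ β in 𝓝 β₀, ∃ φ ∈ Feasible K u (R β), |φ P - φ₀ P| < ε := by
  have hψ₀ : ψ β₀ ∈ Feasible K u (R β₀) := hψF.self_of_nhds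
  -- the coefficients `a i β = φ₀ (g i β)` tend to `0`
  set a : Fin s → ℝ → ℝ := fun i β => φ₀ (g i β) with ha
  have ha0 : ∀ i, a i β₀ = 0 := fun i => hφ₀.2.2 _ (hg₀ i)
  have hac : ∀ i, Tendsto (a i) (𝓝 β₀) (𝓝 0) := fun i => by
    have h : Tendsto (fun β => φ₀ (g i β)) (𝓝 β₀) (𝓝 (φ₀ (g i β₀))) := (hgc φ₀ i).tendsto
    have h0 : φ₀ (g i β₀) = 0 := ha0 i
    rw [h0] at h
    exact h
  -- the error `e β = D Σ |a i β|` and the repair weight `t β = e β / m`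
  set e : ℝ → ℝ := fun β => D * ∑ i, |a i β| with he
  have he0 : ∀ β, 0 ≤ e β := fun β => mul_nonneg hD0 (Finset.sum_nonneg fun i _ => abs_nonneg _)
  have hec : Tendsto e (𝓝 β₀) (𝓝 0) := by
    have h : Tendsto (fun β => D * ∑ i, |a i β|) (𝓝 β₀) (𝓝 (D * ∑ i : Fin s, |(0 : ℝ)|)) :=
      (tendsto_finsetSum _ fun i _ => (hac i).abs).const_mul D
    simpa using h
  set t : ℝ → ℝ := fun β => e β / m with ht
  have ht0 : ∀ β, 0 ≤ t β := fun β => div_nonneg (he0 β) hm.le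
  have htc : Tendsto t (𝓝 β₀) (𝓝 0) := by simpa [ht] using hec.div_const m
  -- the corrected functional `φ₀ ∘ (1 - Q_β)`
  set φt : ℝ → (E →ₗ[ℝ] ℝ) := fun β => φ₀ - ∑ i, a i β • π i with hφtdef
  have hφt : ∀ β x, φt β x = φ₀ x - ∑ i, a i β * π i x := by
    intro β x
    simp only [hφtdef, LinearMap.sub_apply, LinearMap.coe_sum, Finset.sum_apply,
      LinearMap.smul_apply, smul_eq_mul]
  have hφtR : ∀ β, (∀ x ∈ R β, ∑ i, π i x • g i β = x) → ∀ x ∈ R β, φt β x = 0 := by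
    intro β hQβ x hx
    have h := congrArg φ₀ (hQβ x hx)
    rw [map_sum] at h
    simp only [map_smul, smul_eq_mul] at h
    rw [hφt, ← h, sub_eq_zero]
    exact Finset.sum_congr rfl fun i _ => by rw [ha]; ring
  have hφtK : ∀ β, ∀ x ∈ K, -(e β * ψ β₀ x) ≤ φt β x := by
    intro β x hx
    rw [hφt]
    have h0 : 0 ≤ φ₀ x := hφ₀.2.1 x hx
    have h1 : |∑ i, a i β * π i x| ≤ e β * ψ β₀ x := by
      calc |∑ i, a i β * π i x| ≤ ∑ i, |a i β * π i x| := Finset.abs_sum_le_sum_abs _ _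
        _ = ∑ i, |a i β| * |π i x| := Finset.sum_congr rfl fun i _ => abs_mul _ _
        _ ≤ ∑ i, |a i β| * (D * ψ β₀ x) :=
            Finset.sum_le_sum fun i _ => mul_le_mul_of_nonneg_left (hD i x hx) (abs_nonneg _)
        _ = e β * ψ β₀ x := by rw [← Finset.sum_mul, he]; ring
    linarith [(abs_le.1 h1).2]
  -- the repaired functional `χ β = φt β + t β • ψ β`
  set χ : ℝ → (E →ₗ[ℝ] ℝ) := fun β => φt β + t β • ψ β with hχdef
  have hχ : ∀ β x, χ β x = φt β x + t β * ψ β x := by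
    intro β x
    simp only [hχdef, LinearMap.add_apply, LinearMap.smul_apply, smul_eq_mul]
  have hsum : ∀ x : E, Tendsto (fun β => ∑ i, a i β * π i x) (𝓝 β₀) (𝓝 0) := fun x => by
    have h : Tendsto (fun β => ∑ i, a i β * π i x) (𝓝 β₀) (𝓝 (∑ i : Fin s, (0 : ℝ) * π i x)) :=
      tendsto_finsetSum _ fun i _ => (hac i).mul_const (π i x)
    simpa using h
  have htψP : Tendsto (fun β => t β * ψ β P) (𝓝 β₀) (𝓝 0) := by
    refine squeeze_zero_norm' (a := fun β => t β * max B 0) ?_ ?_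
    · filter_upwards [hψP] with β hβ
      rw [Real.norm_eq_abs, abs_mul, abs_of_nonneg (ht0 β)]
      exact mul_le_mul_of_nonneg_left (hβ.trans (le_max_left _ _)) (ht0 β)
    · simpa using htc.mul_const (max B 0)
  have hden : Tendsto (fun β => χ β u) (𝓝 β₀) (𝓝 1) := by
    have h1 : Tendsto (fun β => (1 - ∑ i, a i β * π i u) + t β * 1) (𝓝 β₀)
        (𝓝 (((1 : ℝ) - 0) + 0 * 1)) :=
      (tendsto_const_nhds.sub (hsum u)).add (htc.mul_const 1)
    rw [show ((1 : ℝ) - 0) + 0 * 1 = 1 by norm_num] at h1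
    refine h1.congr' ?_
    filter_upwards [hψF] with β hβ
    show 1 - ∑ i, a i β * π i u + t β * 1 = χ β u
    rw [hχ, hφt, hφ₀.1, hβ.1]
  have hnum : Tendsto (fun β => χ β P) (𝓝 β₀) (𝓝 (φ₀ P)) := by
    have h1 : Tendsto (fun β => (φ₀ P - ∑ i, a i β * π i P) + t β * ψ β P) (𝓝 β₀)
        (𝓝 ((φ₀ P - 0) + 0)) :=
      (tendsto_const_nhds.sub (hsum P)).add htψP
    rw [sub_zero, add_zero] at h1
    refine h1.congr' (Eventually.of_forall fun β => ?_)
    show φ₀ P - ∑ i, a i β * π i P + t β * ψ β P = χ β P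
    rw [hχ, hφt]
  have hratio : Tendsto (fun β => χ β P / χ β u) (𝓝 β₀) (𝓝 (φ₀ P)) := by
    have h := hnum.div hden one_ne_zero
    rwa [div_one] at h
  have hpos : ∀ᶠ β in 𝓝 β₀, 0 < χ β u := hden.eventually (lt_mem_nhds one_pos)
  have hclose : ∀ᶠ β in 𝓝 β₀, |χ β P / χ β u - φ₀ P| < ε := by
    have h := hratio.eventually (Metric.ball_mem_nhds (φ₀ P) hε)
    filter_upwards [h] with β hβ
    have hβ' : dist (χ β P / χ β u) (φ₀ P) < ε := hβ
    rwa [Real.dist_eq] at hβ'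
  filter_upwards [hψF, hψK, hQ, hpos, hclose] with β hF hKβ hQβ hposβ hcl
  refine ⟨(χ β u)⁻¹ • χ β, smul_mem_feasible hposβ (fun x hx => ?_) (fun x hx => ?_), ?_⟩
  · rw [hχ]
    have h1 := hφtK β x hx
    have h3 : t β * (m * ψ β₀ x) ≤ t β * ψ β x := mul_le_mul_of_nonneg_left (hKβ x hx) (ht0 β)
    have h4 : t β * (m * ψ β₀ x) = e β * ψ β₀ x := by
      rw [ht]
      field_simp
    linarith
  · rw [hχ, hφtR β hQβ x hx, hF.2.2 x hx, mul_zero, add_zero]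
  · rw [LinearMap.smul_apply, smul_eq_mul, inv_mul_eq_div]
    exact hcl

/-- ★★ **Lower semicontinuity of the optimal value** (supremum form): if the feasible sets are
inner semicontinuous at `β₀` in the value of `P` (the conclusion of `inner_semicontinuous`), the
supremum of the feasible values of `P` is attained at `β₀`, and the feasible values are bounded
above near `β₀`, then `β ↦ sup {φ P | φ feasible at β}` is lower semicontinuous at `β₀`.
[folklore] -/
theorem lowerSemicontinuousAt_sSup {K : Set E} {u P : E} {R : ℝ → Submodule ℝ E} {β₀ : ℝ}
    (happrox : ∀ φ₀ ∈ Feasible K u (R β₀), ∀ ε : ℝ, 0 < ε →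
      ∀ᶠ β in 𝓝 β₀, ∃ φ ∈ Feasible K u (R β), |φ P - φ₀ P| < ε)
    (hatt : ∃ φ₀ ∈ Feasible K u (R β₀),
      φ₀ P = sSup ((fun φ : E →ₗ[ℝ] ℝ => φ P) '' Feasible K u (R β₀)))
    (hbdd : ∀ᶠ β in 𝓝 β₀, BddAbove ((fun φ : E →ₗ[ℝ] ℝ => φ P) '' Feasible K u (R β))) :
    LowerSemicontinuousAt
      (fun β => sSup ((fun φ : E →ₗ[ℝ] ℝ => φ P) '' Feasible K u (R β))) β₀ := by
  intro y hy
  obtain ⟨φ₀, hφ₀, hφ₀P⟩ := hatt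
  dsimp only at hy
  rw [← hφ₀P] at hy
  have hε : 0 < φ₀ P - y := sub_pos.2 hy
  filter_upwards [happrox φ₀ hφ₀ _ hε, hbdd] with β hβ hbddβ
  obtain ⟨φ, hφ, hclose⟩ := hβ
  have h1 : y < φ P := by
    have h := (abs_lt.1 hclose).1
    linarith
  exact lt_of_lt_of_le h1 (le_csSup hbddβ ⟨φ, hφ, rfl⟩)

/-- ★★ **Upper semicontinuity of the optimal value** (infimum form). [folklore] -/
theorem upperSemicontinuousAt_sInf {K : Set E} {u P : E} {R : ℝ → Submodule ℝ E} {β₀ : ℝ}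
    (happrox : ∀ φ₀ ∈ Feasible K u (R β₀), ∀ ε : ℝ, 0 < ε →
      ∀ᶠ β in 𝓝 β₀, ∃ φ ∈ Feasible K u (R β), |φ P - φ₀ P| < ε)
    (hatt : ∃ φ₀ ∈ Feasible K u (R β₀),
      φ₀ P = sInf ((fun φ : E →ₗ[ℝ] ℝ => φ P) '' Feasible K u (R β₀)))
    (hbdd : ∀ᶠ β in 𝓝 β₀, BddBelow ((fun φ : E →ₗ[ℝ] ℝ => φ P) '' Feasible K u (R β))) :
    UpperSemicontinuousAt
      (fun β => sInf ((fun φ : E →ₗ[ℝ] ℝ => φ P) '' Feasible K u (R β))) β₀ := by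
  intro y hy
  obtain ⟨φ₀, hφ₀, hφ₀P⟩ := hatt
  dsimp only at hy
  rw [← hφ₀P] at hy
  have hε : 0 < y - φ₀ P := sub_pos.2 hy
  filter_upwards [happrox φ₀ hφ₀ _ hε, hbdd] with β hβ hbddβ
  obtain ⟨φ, hφ, hclose⟩ := hβ
  have h1 : φ P < y := by
    have h := (abs_lt.1 hclose).2
    linarith
  exact lt_of_le_of_lt (csInf_le hbddβ ⟨φ, hφ, rfl⟩) h1

end Summit.QuantumFields.GaugeBoot.ConicStability

end
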